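import Summits.QuantumFields.BalabanUV.Beta.GAN24.StripRegularPackaging
import Summits.QuantumFields.BalabanUV.Beta.GAN24.FibreStepResidues

/-!
# `BalabanUV.Beta.GAN24.StripEventually` — binder row G-an2-4 / (CONV-C), road P1-fibre, self-row **L10-EVENTUAL** (helper of p1 row L10 `FibreStrip`):
# (I3′) IS AN EVENTUAL STATEMENT IN `j` — per-`j` strip regularity of `kFibΔ_j` is free, so `StripRegularK` for `j ≥ J` gives `StripRegularK` for all `j`;
# plus the [folklore] LIMIT ENGINE «uniform convergence on a strip + nonvanishing on the real zone ⇒ an EVENTUAL floor on a thinner strip»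

NOT IN PRINT; OUR PROOF ATTEMPT.  HONEST FRAMING (cell contract, verbatim): «discharging `BetaPertH` makes Bałaban's UV stability UNCONDITIONAL — a real
constructive-QFT result; it is NOT the continuum limit and NOT the Clay problem.»  HONEST DEPENDENCY (verbatim): «continuum YM on T⁴ ⇐ BetaPertH ∧ nine spine
estimates (0/9 proved); BetaPertH ⇐ (D1) ∧ (D4) ∧ CAP+tail; G-an2-4 gates asym, D1 and NE2/3/4.»  [folklore] bookkeeping + one compactness / uniform-limit engine
(Mathlib; an2's `BlochFibreMatrix.det_trigPolySymbol_ne_zero`; lit2's `FibreInverseDecay`; leaf-06's `StripRegularPackaging`; leaf-01's `FibreStepResidues`; the typer's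
`ConvCKOfShapes` — all BY NAME).  No estimate of the K-slot, no cited fact, no wall binder, no `def … : Prop`.  NOTHING of (CONV-C)'s K-slot `ConvCK 3 Lc` is discharged
here; the `j`-UNIFORM content of (I3′) for LARGE `j` remains exactly what it was.  NOT summit progress.

## What is proved (generic `d`, blocking factor `Lc ≥ 1`, units `sf sm : ℕ → ℝ` as parameters unless the literal `sfStep/smStep` are named)
* §1 PER-`j` FREENESS.  `exists_stripRegular_fibInv`: for every block side `N`, SOME strip `κ_N > 0` and bound `M_N` make every inverse-fibre entry
  `CombesThomasFibre.fibInv N i j` strip regular (an2's `det_trigPolySymbol_ne_zero` at every real momentum + lit `trigPolySymbol_exists_stripRegular_inv`,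
  compactness).  Hence `stripHolo_kFibW_of_fibInv` / `stripHolo_kFibΔ_of_fibInv` and **`exists_stripRegular_kFibΔ`**: for each FIXED `j`,
  `∃ κ_j > 0, ∃ C_j ≥ 0, ∀ x′ y′ a b, StripRegular (kFibΔ Lc sf sm j a x′ b y′) κ_j C_j` — ONE pair `(κ_j, C_j)` for all base points and legs, because `kFibΔ`
  sees `(x′, y′)` only through the `Lc^{d+1} × Lc^{d+1}` residue pairs (`FibreStepResidues.kFibΔ_eq_repZ`) and `Fib d` is finite.
* §2 **EVENTUAL ⇒ UNIFORM.**  `stripRegular_all_of_eventually`: `0 < κ` and `∀ j ≥ J, ∀ x′ y′ a b, StripRegular (kFibΔ … j …) κ Cst` give `κ′ ∈ (0, κ]`, `Cst′ ≥ Cst`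
  with `StripRegular (kFibΔ … j …) κ′ Cst′` for ALL `j` (`κ′` = min, `Cst′` = max over the finitely many `j < J`; `StripRegular.of_le/.mono`).  Literal-unit forms:
  **`stripRegularK_of_eventually`** (`ConvCKOfShapes.StripRegularK`), `unitDecayK_of_eventually`, **`convCK_of_eventually_strip_rate`**, and the (U1)/(U2) form
  **`convCK_of_eventually_det_bound_rate`** — leaf-06's `StripRegularPackaging.convCK_of_det_bound_rate` with (U1) `det ≠ 0 on Strip κ` and (U2) `‖kFibΔ_j‖ ≤ Cst
  on Strip κ` asked ONLY for `j ≥ J`; a residue-only variant `stripRegularK_of_eventually_repZ`.  So every route to L10 (two-anchor Neumann (M4), the bordered zero-alias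
  limit (M2), the regularised closed form (M3)/M♯, the form method (M1)) may START AT ITS OWN `J`; the small `j` cost nothing.
* §3 THE LIMIT ENGINE (generic `d`, multipliers `F : ℕ → (Fin d → ℂ) → ℂ` on `B4Strip.Strip d κ₀`).  `exists_strip_lower_eventually_of_tendstoUniformlyOn`:
  `TendstoUniformlyOn F Flim atTop (Strip d κ₀)`, `Flim` continuous on the strip and `≠ 0` on the real zone ⇒ `∃ κ ∈ (0, κ₀], c > 0, n₀, ∀ n ≥ n₀, ∀ p ∈ Strip d κ, c ≤ ‖F n p‖`
  (lit `exists_strip_lower_of_ne_zero` on the limit + uniform closeness).  `tendstoUniformlyOn_of_summable_rate`: summable one-step rates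
  `‖F (n+1) p − F n p‖ ≤ a n` on a set build the uniform limit (`cauchySeq_of_dist_le_of_summable`, `dist_le_tsum_of_dist_le_of_tendsto`, tails → 0), with the
  tail bound `‖F n p − Flim p‖ ≤ Σ_m a (n+m)`.  **`exists_strip_lower_eventually_of_summable_rate`**: continuity of each `F n` on the strip + summable rates + at each real
  momentum an EVENTUAL floor `0 < m_s ≤ ‖F n (ofRealVec s)‖` (primed form: one uniform `m`) ⇒ the eventual strip floor (limit built inside;
  `TendstoUniformlyOn.continuousOn`); geometric corollary
  `exists_strip_lower_eventually_of_geometric_rate` (`a n = C·θ^n`, `0 ≤ θ < 1` — the cell's two-level-rate currency).  `norm_inv_apply_le_of_det_lower`: the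
  inverse-entry bound `‖(A)⁻¹ i j‖ ≤ K / c` from `c ≤ ‖det A‖` and `‖adjugate A i j‖ ≤ K` (for an (U2)-type a-priori bound in a determinant route).
  INTENDED USE: `F n p := det` of an `N`-scaled pinned zero-alias block at `N = Lc^(n+1)` (gan24-p1's ruling l.3079 (2); leaf-03-g5's (M2) `B_N`; leaf-06's M♯),
  whose entries are entire in `p` with summable two-level rates on a strip ⇒ (U1) for `j ≥ J` with ONE `κ`, then §2.
Unit `b2b-balaban-gan24-formalise-leaf-14` (G-an2-4 formalisation swarm, leaf prover 14, gen 9), 2026-08-20.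
-/

noncomputable section

open Complex Filter Topology Finset
open scoped BigOperators
open Literature.MathematicalPhysics.QuantumFieldTheory
open Literature.MathematicalPhysics.QuantumFieldTheory.Balaban1983to89
open Literature.MathematicalPhysics.QuantumFieldTheory.Balaban1983to89.Beta
open Literature.Probability.LatticeModels (TorusSite Torus.proj)
open LatticeForm (repZ)
open B4Strip (ofRealVec Strip reVec)
open B4ContourShift (BZ StripRegular ofRealVec_mem_Strip)
open B5Strip145Analytic (strip_mono)
open FibreInverseDecay (StripHolo trigPolySymbol cphase stripHolo_cphase stripHolo_const stripHolo_of_stripRegular exists_strip_lower_of_ne_zero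
  trigPolySymbol_exists_stripRegular_inv inv_apply_eq)
open BlochFibreMatrix (Idx stencil pieceMatrix det_trigPolySymbol_ne_zero)
open OneStepResolventKernel (Fib)
open Summit.QuantumFields.BalabanUV.Beta.GAN24.CombesThomas (ConvCK UnitDecayK sfStep smStep)
open Summit.QuantumFields.BalabanUV.Beta.GAN24.CombesThomasFibre (fibInv legIdx)
open Summit.QuantumFields.BalabanUV.Beta.GAN24.CombesThomasFibreStep (kFibW kFib kFibΔ unitDecayK_of_stripRegular)
open Summit.QuantumFields.BalabanUV.Beta.GAN24.ConvCKOfShapes (StripRegularK RealRateK convCK_of_strip_rate)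
open Summit.QuantumFields.BalabanUV.Beta.GAN24.StripRegularPackaging (stripRegular_of_stripHolo convCK_of_det_bound_rate stripRegular_kFibΔ)
open Summit.QuantumFields.BalabanUV.Beta.GAN24.FibreStepResidues (kFibΔ_eq_repZ)

namespace Summit.QuantumFields.BalabanUV.Beta.GAN24.StripEventually

variable {d : ℕ}

/-! ## §1 Per-`j` freeness: strip regularity of `fibInv`, `kFibW`, `kFibΔ` for each FIXED block side, by compactness -/

section Fibre

variable {N : ℕ} [NeZero N]

/-- [folklore] For every block side `N` there are `κ > 0` and `M ≥ 0` making EVERY inverse-fibre entry `fibInv N i j` strip regular on `Strip (d+1) κ`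
(an2's `det_trigPolySymbol_ne_zero` at every real momentum + lit2's `trigPolySymbol_exists_stripRegular_inv`; pure compactness — `κ`, `M` depend on `N`). -/
theorem exists_stripRegular_fibInv (N : ℕ) [NeZero N] :
    ∃ κ M : ℝ, 0 < κ ∧ 0 ≤ M ∧ ∀ i j : Idx (d + 1) N, StripRegular (fibInv N i j) κ M := by
  obtain ⟨κ, M, hκ, hM, h⟩ := trigPolySymbol_exists_stripRegular_inv (stencil (d + 1)) (pieceMatrix (N := N))
    (fun s _ => det_trigPolySymbol_ne_zero s)
  exact ⟨κ, M, hκ, hM, fun i j => by unfold fibInv; exact h i j⟩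

/-- [folklore] The phase-dressed leg sum `kFibW` is strip holomorphic as soon as the inverse-fibre entries are (finite sum of constant · `cphase` · `fibInv`). -/
theorem stripHolo_kFibW_of_fibInv {κ : ℝ} (h : ∀ i j : Idx (d + 1) N, StripHolo (fibInv N i j) κ)
    (M : ℕ) (sf sm : ℝ) (a : Fib d) (x' : Fin (d + 1) → ℤ) (b : Fib d) (y' : Fin (d + 1) → ℤ) :
    StripHolo (kFibW N M sf sm a x' b y') κ := by
  unfold kFibW
  refine StripHolo.finset_sum _ fun ii _ => ?_
  exact (stripHolo_const _ κ).mul ((stripHolo_cphase _ κ).mul (h _ _))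

end Fibre

section Step

variable {Lc : ℕ} [NeZero Lc]

/-- [folklore] `kFibΔ_j = cphase (quo Lc y′ − quo Lc x′) · kFib_j` is strip holomorphic as soon as the step-`j` inverse-fibre entries are. -/
theorem stripHolo_kFibΔ_of_fibInv {κ : ℝ} (sf sm : ℕ → ℝ) (j : ℕ)
    (h : ∀ i i' : Idx (d + 1) (Lc ^ (j + 1)), StripHolo (fibInv (Lc ^ (j + 1)) i i') κ)
    (a : Fib d) (x' : Fin (d + 1) → ℤ) (b : Fib d) (y' : Fin (d + 1) → ℤ) :
    StripHolo (kFibΔ Lc sf sm j a x' b y') κ := by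
  unfold kFibΔ kFib
  exact (stripHolo_cphase _ κ).mul (stripHolo_kFibW_of_fibInv h _ _ _ a x' b y')

/-- [folklore] **PER-`j` FREENESS of (I3′).**  For each FIXED `j` there are `κ_j > 0` and `C_j ≥ 0` with
`StripRegular (kFibΔ Lc sf sm j a x′ b y′) κ_j C_j` for ALL base points `x′, y′` and legs `a, b` — one pair for all of them, because `kFibΔ` depends on
`(x′, y′)` only through the finitely many residue pairs (`FibreStepResidues.kFibΔ_eq_repZ`) and `Fib d` is finite; the bound per residue class is
compactness (`StripHolo.exists_stripRegular`).  The `j`-dependence of `(κ_j, C_j)` is NOT controlled — that is the content of (I3′). -/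
theorem exists_stripRegular_kFibΔ (sf sm : ℕ → ℝ) (j : ℕ) :
    ∃ κ C : ℝ, 0 < κ ∧ 0 ≤ C ∧
      ∀ (x' y' : Fin (d + 1) → ℤ) (a b : Fib d), StripRegular (kFibΔ Lc sf sm j a x' b y') κ C := by
  classical
  obtain ⟨κ, M, hκ, -, hF⟩ := exists_stripRegular_fibInv (d := d) (Lc ^ (j + 1))
  have hH : ∀ i i' : Idx (d + 1) (Lc ^ (j + 1)), StripHolo (fibInv (Lc ^ (j + 1)) i i') κ :=
    fun i i' => stripHolo_of_stripRegular (hF i i')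
  -- one bound per (residue pair, leg pair), by compactness
  have hcls : ∀ q : (TorusSite (d + 1) Lc × TorusSite (d + 1) Lc) × (Fib d × Fib d),
      ∃ C : ℝ, 0 ≤ C ∧ StripRegular (kFibΔ Lc sf sm j q.2.1 (repZ q.1.1) q.2.2 (repZ q.1.2)) κ C :=
    fun q => (stripHolo_kFibΔ_of_fibInv sf sm j hH q.2.1 (repZ q.1.1) q.2.2 (repZ q.1.2)).exists_stripRegular
  choose C hC0 hC using hcls
  refine ⟨κ, ∑ q, C q, hκ, Finset.sum_nonneg fun q _ => hC0 q, fun x' y' a b => ?_⟩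
  have hle : C ((Torus.proj Lc x', Torus.proj Lc y'), (a, b)) ≤ ∑ q, C q :=
    Finset.single_le_sum (fun q _ => hC0 q) (Finset.mem_univ _)
  rw [kFibΔ_eq_repZ]
  exact (hC ((Torus.proj Lc x', Torus.proj Lc y'), (a, b))).mono hle

/-! ## §2 EVENTUAL ⇒ UNIFORM: strip regularity for `j ≥ J` with one `(κ, Cst)` gives it for all `j` with one `(κ′, Cst′)` -/

/-- [folklore] **EVENTUAL ⇒ UNIFORM.**  If ONE pair `(κ, Cst)`, `κ > 0`, serves every `j ≥ J` (all base points and legs), then some pair `(κ′, Cst′)` with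
`0 < κ′ ≤ κ`, `Cst ≤ Cst′` serves EVERY `j`: the finitely many `j < J` each have their own pair by `exists_stripRegular_kFibΔ`; take `κ′` = the minimum and
`Cst′` = the maximum (`StripRegular.of_le`, `StripRegular.mono`). -/
theorem stripRegular_all_of_eventually (sf sm : ℕ → ℝ) {κ Cst : ℝ} (hκ : 0 < κ) (J : ℕ)
    (h : ∀ j, J ≤ j → ∀ (x' y' : Fin (d + 1) → ℤ) (a b : Fib d), StripRegular (kFibΔ Lc sf sm j a x' b y') κ Cst) :
    ∃ κ' Cst' : ℝ, 0 < κ' ∧ κ' ≤ κ ∧ Cst ≤ Cst' ∧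
      ∀ (j : ℕ) (x' y' : Fin (d + 1) → ℤ) (a b : Fib d), StripRegular (kFibΔ Lc sf sm j a x' b y') κ' Cst' := by
  classical
  choose κj Cj hκj hCj hj using fun j : Fin J => exists_stripRegular_kFibΔ (d := d) (Lc := Lc) sf sm (j : ℕ)
  -- a common positive half-width below `κ` and every `κj`
  obtain ⟨κ₀, hκ₀, hκ₀le, hκ₀j⟩ : ∃ κ₀ : ℝ, 0 < κ₀ ∧ κ₀ ≤ κ ∧ ∀ j : Fin J, κ₀ ≤ κj j := by
    rcases isEmpty_or_nonempty (Fin J) with hJ | hJ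
    · exact ⟨κ, hκ, le_rfl, fun j => (IsEmpty.false j).elim⟩
    · obtain ⟨j₀, -, hj₀⟩ := Finset.exists_min_image Finset.univ (fun j : Fin J => κj j) Finset.univ_nonempty
      exact ⟨min κ (κj j₀), lt_min hκ (hκj j₀), min_le_left _ _,
        fun j => (min_le_right _ _).trans (hj₀ j (Finset.mem_univ j))⟩
  refine ⟨κ₀, max Cst (∑ j : Fin J, Cj j), hκ₀, hκ₀le, le_max_left _ _, fun j x' y' a b => ?_⟩
  by_cases hjJ : J ≤ j
  · exact ((h j hjJ x' y' a b).of_le hκ₀le).mono (le_max_left _ _)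
  · have hlt : j < J := Nat.lt_of_not_le hjJ
    have hle : Cj ⟨j, hlt⟩ ≤ ∑ j' : Fin J, Cj j' := Finset.single_le_sum (fun j' _ => hCj j') (Finset.mem_univ _)
    exact ((hj ⟨j, hlt⟩ x' y' a b).of_le (hκ₀j ⟨j, hlt⟩)).mono (hle.trans (le_max_right _ _))

/-- [folklore] **`StripRegularK` FROM ITS EVENTUAL FORM** (literal units `(sfStep Lc, smStep d Lc)`): shape A of the K-slot (`ConvCKOfShapes.StripRegularK`, = (I3′))
follows from the same statement asked only for `j ≥ J`, with a possibly thinner strip `κ′ ∈ (0, κ]` and a larger bound. -/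
theorem stripRegularK_of_eventually {κ Cst : ℝ} (hκ : 0 < κ) (J : ℕ)
    (h : ∀ j, J ≤ j → ∀ (x' y' : Fin (d + 1) → ℤ) (a b : Fib d), StripRegular (kFibΔ Lc (sfStep Lc) (smStep d Lc) j a x' b y') κ Cst) :
    ∃ κ' Cst' : ℝ, 0 < κ' ∧ κ' ≤ κ ∧ Cst ≤ Cst' ∧ StripRegularK d Lc κ' Cst' :=
  stripRegular_all_of_eventually (sfStep Lc) (smStep d Lc) hκ J h

/-- [folklore] Residue-only eventual form: it suffices to have the eventual strip bound at the `Lc^{d+1} × Lc^{d+1}` box representatives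
(`FibreStepResidues.kFibΔ_eq_repZ`). -/
theorem stripRegularK_of_eventually_repZ {κ Cst : ℝ} (hκ : 0 < κ) (J : ℕ)
    (h : ∀ j, J ≤ j → ∀ (zx zy : TorusSite (d + 1) Lc) (a b : Fib d),
      StripRegular (kFibΔ Lc (sfStep Lc) (smStep d Lc) j a (repZ zx) b (repZ zy)) κ Cst) :
    ∃ κ' Cst' : ℝ, 0 < κ' ∧ κ' ≤ κ ∧ Cst ≤ Cst' ∧ StripRegularK d Lc κ' Cst' :=
  stripRegularK_of_eventually hκ J fun j hj x' y' a b => by rw [kFibΔ_eq_repZ]; exact h j hj _ _ a b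

/-- [folklore] The wall's uniform-decay binder from the EVENTUAL strip statement (general units): `∃ κ′ ∈ (0, κ], Cst′ ≥ Cst` with
`UnitDecayK d Lc sf sm (Cst′·e^{2κ′}) (κ′/((d+1)·Lc))` (`CombesThomasFibreStep.unitDecayK_of_stripRegular` BY NAME). -/
theorem unitDecayK_of_eventually (sf sm : ℕ → ℝ) {κ Cst : ℝ} (hκ : 0 < κ) (J : ℕ)
    (h : ∀ j, J ≤ j → ∀ (x' y' : Fin (d + 1) → ℤ) (a b : Fib d), StripRegular (kFibΔ Lc sf sm j a x' b y') κ Cst) :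
    ∃ κ' Cst' : ℝ, 0 < κ' ∧ κ' ≤ κ ∧ Cst ≤ Cst' ∧ UnitDecayK d Lc sf sm (Cst' * Real.exp (2 * κ')) (κ' / ((d + 1) * Lc)) := by
  obtain ⟨κ', Cst', hκ', hle, hC, hall⟩ := stripRegular_all_of_eventually sf sm hκ J h
  exact ⟨κ', Cst', hκ', hle, hC, unitDecayK_of_stripRegular sf sm hκ'.le hall⟩

/-- [folklore] **THE K-SLOT FROM AN EVENTUAL SHAPE A + SHAPE B** (literal units): `ConvCK d Lc` from strip regularity of `kFibΔ_j` for `j ≥ J` only (one `κ > 0`,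
one `Cst`) and the real-zone rate (I2′) (`ConvCKOfShapes.convCK_of_strip_rate` BY NAME on the uniformised pair). -/
theorem convCK_of_eventually_strip_rate {κ Cst c θ : ℝ} (hκ : 0 < κ) (hc : 0 ≤ c) (hθ0 : 0 ≤ θ) (hθ1 : θ < 1) (J : ℕ)
    (hA : ∀ j, J ≤ j → ∀ (x' y' : Fin (d + 1) → ℤ) (a b : Fib d), StripRegular (kFibΔ Lc (sfStep Lc) (smStep d Lc) j a x' b y') κ Cst)
    (hB : RealRateK d Lc c θ) : ConvCK d Lc := by
  obtain ⟨κ', Cst', hκ', -, -, hall⟩ := stripRegularK_of_eventually hκ J hA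
  exact convCK_of_strip_rate hκ' hc hθ0 hθ1 hall hB

/-- [folklore] **THE K-SLOT FROM EVENTUAL (U1)+(U2) + (I2′)**: leaf-06's `StripRegularPackaging.convCK_of_det_bound_rate` with (U1) «no zero of the step-`j` fibre
determinant on `Strip (d+1) κ`» and (U2) «`‖kFibΔ_j‖ ≤ Cst` on that strip» asked ONLY for `j ≥ J` — any Neumann / rate / limit argument may start at its own `J`. -/
theorem convCK_of_eventually_det_bound_rate {κ Cst c θ : ℝ} (hκ : 0 < κ) (hc : 0 ≤ c) (hθ0 : 0 ≤ θ) (hθ1 : θ < 1) (J : ℕ)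
    (hdet : ∀ j, J ≤ j → ∀ p ∈ Strip (d + 1) κ, (trigPolySymbol (stencil (d + 1)) (pieceMatrix (N := Lc ^ (j + 1))) p).det ≠ 0)
    (hC : ∀ j, J ≤ j → ∀ (x' y' : Fin (d + 1) → ℤ) (a b : Fib d), ∀ p ∈ Strip (d + 1) κ,
      ‖kFibΔ Lc (sfStep Lc) (smStep d Lc) j a x' b y' p‖ ≤ Cst)
    (hB : RealRateK d Lc c θ) : ConvCK d Lc :=
  convCK_of_eventually_strip_rate hκ hc hθ0 hθ1 J
    (fun j hj x' y' a b => stripRegular_kFibΔ hκ.le _ _ j (hdet j hj) a x' b y' (hC j hj x' y' a b)) hB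

end Step

/-! ## §3 The limit engine: uniform convergence on a strip + nonvanishing on the real zone ⇒ an EVENTUAL floor on a thinner strip -/

section Limit

variable {F : ℕ → (Fin d → ℂ) → ℂ}

/-- [folklore] **EVENTUAL STRIP FLOOR FROM A UNIFORM LIMIT.**  If `F n → Flim` uniformly on `Strip d κ₀` (`κ₀ > 0`), `Flim` is continuous there and does not vanish at
the real momenta of the zone, then for some `0 < κ ≤ κ₀`, `c > 0` and `n₀`: `c ≤ ‖F n p‖` for all `n ≥ n₀`, `p ∈ Strip d κ` (lit `exists_strip_lower_of_ne_zero` bounds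
`‖Flim‖ ≥ 2c` on a thinner strip; uniform closeness `< c` transfers it). -/
theorem exists_strip_lower_eventually_of_tendstoUniformlyOn {Flim : (Fin d → ℂ) → ℂ} {κ₀ : ℝ} (hκ₀ : 0 < κ₀)
    (hcont : ContinuousOn Flim (Strip d κ₀)) (hne : ∀ s ∈ BZ d, Flim (ofRealVec s) ≠ 0)
    (hconv : TendstoUniformlyOn F Flim atTop (Strip d κ₀)) :
    ∃ κ c : ℝ, ∃ n₀ : ℕ, 0 < κ ∧ κ ≤ κ₀ ∧ 0 < c ∧ ∀ n, n₀ ≤ n → ∀ p ∈ Strip d κ, c ≤ ‖F n p‖ := by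
  obtain ⟨κ, c, hκ, hκle, hc, hlow⟩ := exists_strip_lower_of_ne_zero hκ₀ hcont hne
  rw [Metric.tendstoUniformlyOn_iff] at hconv
  obtain ⟨n₀, hn₀⟩ := eventually_atTop.1 (hconv (c / 2) (half_pos hc))
  refine ⟨κ, c / 2, n₀, hκ, hκle, half_pos hc, fun n hn p hp => ?_⟩
  have h1 : dist (Flim p) (F n p) < c / 2 := hn₀ n hn p (strip_mono hκle hp)
  rw [dist_eq_norm] at h1
  have h2 : c ≤ ‖Flim p‖ := hlow p hp
  have h3 : ‖Flim p‖ - ‖F n p‖ ≤ ‖Flim p - F n p‖ := norm_sub_norm_le _ _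
  linarith

/-- [folklore] **UNIFORM LIMIT FROM SUMMABLE ONE-STEP RATES.**  If `‖F (n+1) p − F n p‖ ≤ a n` on a set `S` with `Σ a < ∞`, the pointwise limits
`Flim p := lim F n p` exist, `F n → Flim` UNIFORMLY on `S`, and `‖F n p − Flim p‖ ≤ Σ_m a (n+m)` (`cauchySeq_of_dist_le_of_summable`,
`dist_le_tsum_of_dist_le_of_tendsto`, and the tails of a summable series tend to `0`). -/
theorem tendstoUniformlyOn_of_summable_rate {S : Set (Fin d → ℂ)} {a : ℕ → ℝ} (ha : Summable a)
    (hrate : ∀ n, ∀ p ∈ S, ‖F (n + 1) p - F n p‖ ≤ a n) :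
    ∃ Flim : (Fin d → ℂ) → ℂ, TendstoUniformlyOn F Flim atTop S ∧ (∀ p ∈ S, Tendsto (fun n => F n p) atTop (𝓝 (Flim p))) ∧
      ∀ n, ∀ p ∈ S, ‖F n p - Flim p‖ ≤ ∑' m, a (n + m) := by
  refine ⟨fun p => limUnder atTop (fun n => F n p), ?_, ?_, ?_⟩
  · -- pointwise convergence with the tail bound, then uniformity from the tails
    have hpt : ∀ p ∈ S, Tendsto (fun n => F n p) atTop (𝓝 (limUnder atTop (fun n => F n p))) ∧
        ∀ n, dist (F n p) (limUnder atTop (fun n => F n p)) ≤ ∑' m, a (n + m) := by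
      intro p hp
      have hstep : ∀ n, dist (F n p) (F n.succ p) ≤ a n := fun n => by
        rw [dist_comm, dist_eq_norm]; exact hrate n p hp
      have hcs : CauchySeq (fun n => F n p) := cauchySeq_of_dist_le_of_summable a hstep ha
      exact ⟨hcs.tendsto_limUnder, fun n => dist_le_tsum_of_dist_le_of_tendsto a hstep ha hcs.tendsto_limUnder n⟩
    have htail : Tendsto (fun i => ∑' m, a (i + m)) atTop (𝓝 0) := by
      refine (tendsto_sum_nat_add a).congr fun i => ?_
      exact tsum_congr fun m => by rw [add_comm]
    rw [Metric.tendstoUniformlyOn_iff]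
    intro ε hε
    obtain ⟨n₀, hn₀⟩ := eventually_atTop.1 (htail.eventually (eventually_lt_nhds hε))
    refine eventually_atTop.2 ⟨n₀, fun n hn p hp => ?_⟩
    rw [dist_comm]
    exact ((hpt p hp).2 n).trans_lt (hn₀ n hn)
  · intro p hp
    have hstep : ∀ n, dist (F n p) (F n.succ p) ≤ a n := fun n => by
      rw [dist_comm, dist_eq_norm]; exact hrate n p hp
    exact (cauchySeq_of_dist_le_of_summable a hstep ha).tendsto_limUnder
  · intro n p hp
    have hstep : ∀ n, dist (F n p) (F n.succ p) ≤ a n := fun n => by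
      rw [dist_comm, dist_eq_norm]; exact hrate n p hp
    have hcs : CauchySeq (fun n => F n p) := cauchySeq_of_dist_le_of_summable a hstep ha
    rw [← dist_eq_norm]
    exact dist_le_tsum_of_dist_le_of_tendsto a hstep ha hcs.tendsto_limUnder n

/-- [folklore] **EVENTUAL STRIP FLOOR FROM SUMMABLE RATES AND A REAL-ZONE FLOOR** (the limit built inside): each `F n` continuous on `Strip d κ₀`
(`κ₀ > 0`), summable one-step rates `‖F (n+1) p − F n p‖ ≤ a n` on the strip, and at every real momentum `s` of the zone an EVENTUAL floor
`0 < m_s ≤ ‖F n (ofRealVec s)‖` (for all large `n`) ⇒ `∃ κ ∈ (0, κ₀], c > 0, n₀, ∀ n ≥ n₀, ∀ p ∈ Strip d κ, c ≤ ‖F n p‖`.  (The limit is continuous by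
`TendstoUniformlyOn.continuousOn` and does not vanish at the real momenta.) -/
theorem exists_strip_lower_eventually_of_summable_rate {κ₀ : ℝ} {a : ℕ → ℝ} (hκ₀ : 0 < κ₀)
    (hcont : ∀ n, ContinuousOn (F n) (Strip d κ₀)) (ha : Summable a)
    (hrate : ∀ n, ∀ p ∈ Strip d κ₀, ‖F (n + 1) p - F n p‖ ≤ a n)
    (hlow : ∀ s ∈ BZ d, ∃ m : ℝ, 0 < m ∧ ∀ᶠ n in atTop, m ≤ ‖F n (ofRealVec s)‖) :
    ∃ κ c : ℝ, ∃ n₀ : ℕ, 0 < κ ∧ κ ≤ κ₀ ∧ 0 < c ∧ ∀ n, n₀ ≤ n → ∀ p ∈ Strip d κ, c ≤ ‖F n p‖ := by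
  obtain ⟨Flim, hconv, hpt, -⟩ := tendstoUniformlyOn_of_summable_rate (F := F) ha hrate
  have hclim : ContinuousOn Flim (Strip d κ₀) := hconv.continuousOn (Frequently.of_forall hcont)
  have hne : ∀ s ∈ BZ d, Flim (ofRealVec s) ≠ 0 := by
    intro s hs
    obtain ⟨m, hm, hev⟩ := hlow s hs
    have hlim := (hpt (ofRealVec s) (ofRealVec_mem_Strip hκ₀.le hs)).norm
    have hge : m ≤ ‖Flim (ofRealVec s)‖ := ge_of_tendsto hlim hev
    exact norm_pos_iff.mp (hm.trans_le hge)
  exact exists_strip_lower_eventually_of_tendstoUniformlyOn hκ₀ hclim hne hconv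

/-- [folklore] The same with a UNIFORM real-zone floor `0 < m ≤ ‖F n (ofRealVec s)‖` for all `n` and all `s ∈ BZ d`. -/
theorem exists_strip_lower_eventually_of_summable_rate' {κ₀ m : ℝ} {a : ℕ → ℝ} (hκ₀ : 0 < κ₀)
    (hcont : ∀ n, ContinuousOn (F n) (Strip d κ₀)) (ha : Summable a)
    (hrate : ∀ n, ∀ p ∈ Strip d κ₀, ‖F (n + 1) p - F n p‖ ≤ a n)
    (hm : 0 < m) (hlow : ∀ n, ∀ s ∈ BZ d, m ≤ ‖F n (ofRealVec s)‖) :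
    ∃ κ c : ℝ, ∃ n₀ : ℕ, 0 < κ ∧ κ ≤ κ₀ ∧ 0 < c ∧ ∀ n, n₀ ≤ n → ∀ p ∈ Strip d κ, c ≤ ‖F n p‖ :=
  exists_strip_lower_eventually_of_summable_rate hκ₀ hcont ha hrate
    fun s hs => ⟨m, hm, Eventually.of_forall fun n => hlow n s hs⟩

/-- [folklore] Geometric-rate corollary (the cell's two-level-rate currency `‖X_{j+1} − X_j‖ ≤ C·θ^j`, `0 ≤ θ < 1`), eventual real-zone floors. -/
theorem exists_strip_lower_eventually_of_geometric_rate {κ₀ C θ : ℝ} (hκ₀ : 0 < κ₀)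
    (hcont : ∀ n, ContinuousOn (F n) (Strip d κ₀)) (hθ0 : 0 ≤ θ) (hθ1 : θ < 1)
    (hrate : ∀ n, ∀ p ∈ Strip d κ₀, ‖F (n + 1) p - F n p‖ ≤ C * θ ^ n)
    (hlow : ∀ s ∈ BZ d, ∃ m : ℝ, 0 < m ∧ ∀ᶠ n in atTop, m ≤ ‖F n (ofRealVec s)‖) :
    ∃ κ c : ℝ, ∃ n₀ : ℕ, 0 < κ ∧ κ ≤ κ₀ ∧ 0 < c ∧ ∀ n, n₀ ≤ n → ∀ p ∈ Strip d κ, c ≤ ‖F n p‖ :=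
  exists_strip_lower_eventually_of_summable_rate hκ₀ hcont ((summable_geometric_of_lt_one hθ0 hθ1).mul_left C) hrate hlow

end Limit

/-! ## §4 A determinant-route helper: inverse entries from a determinant floor and an adjugate bound -/

/-- [folklore] `‖A⁻¹ i j‖ ≤ K / c` from `0 < c ≤ ‖det A‖` and `‖adjugate A i j‖ ≤ K` (`A⁻¹ = (det A)⁻¹ • adjugate A`, lit `inv_apply_eq`). -/
theorem norm_inv_apply_le_of_det_lower {n : Type*} [Fintype n] [DecidableEq n] (A : Matrix n n ℂ) {c K : ℝ} (hc : 0 < c)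
    (hdet : c ≤ ‖A.det‖) (hadj : ∀ i j, ‖A.adjugate i j‖ ≤ K) (i j : n) : ‖A⁻¹ i j‖ ≤ K / c := by
  rw [inv_apply_eq, norm_mul, norm_inv, mul_comm]
  have hK : 0 ≤ K := (norm_nonneg _).trans (hadj i j)
  rw [div_eq_mul_inv]
  exact mul_le_mul (hadj i j) (inv_anti₀ hc hdet) (inv_nonneg.mpr (norm_nonneg _)) hK

end Summit.QuantumFields.BalabanUV.Beta.GAN24.StripEventually

end
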